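import Summits.QuantumFields.QCD.Theorems.TiltedFlatness.Negative.MasslessKernel
import Summits.QuantumFields.QCD.Theorems.TiltedFlatness.Negative.TwoWellFloor
import Literature.Barriers.QuantumFields.DiscreteSubgroupFreezing
import Literature.MathematicalPhysics.QuantumFieldTheory.QCDPhaseQuenched

/-!
# Crux `TiltedFlatness` (K3 of route `PauliWegnerSea`), negative side — the free one-star fibre

Support file of the standing disprover of item stmt-QuantumFields-14070: the concrete fibre on
which the load-bearing analysis of the repaired crux `C′` runs (`FlatnessNeedsLoss.lean`,
`NfDependence.lean`): torus `(ℤ/4)⁴`, trivial outside field `U ≡ 1`, one star (`x = y = 0`),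
massless Wilson fermions.

* `freeStar_pureGauge`: a field that is `1` off the star of the origin and FLAT is pure gauge at
  the origin (forward links `h`, backward links `h⁻¹`) — seven plaquettes through the star;
* `det_wilsonDirac_freeStar_eq_zero`: such a field carries the parallel colour field
  `ψ(0) = h e₁`, `ψ(z) = e₁` (`z ≠ 0`), so by the massless kernel theorem
  (`det_wilsonDirac_massless_eq_zero_iff`, file `MasslessKernel`) its massless Wilson determinant
  vanishes — the fermionic weight is ZERO on every minimiser of the star action
  (`flat_of_wilsonAction_eq_zero`, `wilsonAction_const_one`, `wilsonAction_nonneg'`);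
* `det_wilsonDirac_twisted_ne_zero`: twisting the single link `(0, ê₀)` by the centre-free
  element `diag(i, i, −1) ∈ SU(3)` (`twist_mem_specialUnitaryGroup`) leaves NO parallel field
  (`ψ` is shift-invariant along `ê₁, ê₂, ê₃`, along `ê₀` away from the origin, and the twist kills
  the common value), so the weight is POSITIVE there;
* continuity helpers stated at generic side `L` (`continuous_wilsonAction_comp`,
  `continuous_normDet_comp`, `continuous_normDetWilson_comp`) so that no concrete `Fintype` is
  ever unfolded by unification.

Standard material. [folklore]
-/

namespace Summit.QuantumFields.QCD.Theorems.TiltedFlatnessNegative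

open Matrix
open Literature.MathematicalPhysics.QuantumFieldTheory Literature.MathematicalPhysics.QuantumLattice
  Literature.Probability.LatticeModels

section FreeStar

/-- The neighbouring site is the translate by a unit vector. -/
theorem shift_eq (z : TorusSite 4 4) (μ : Fin 4) : Site.shift z μ = z + Pi.single μ 1 := rfl

/-- Unit vectors are non-zero on `(ℤ/4)⁴`. -/
theorem single_ne_zero (μ : Fin 4) : (Pi.single μ 1 : TorusSite 4 4) ≠ 0 := by
  intro h; have := congrFun h μ; simp at this; exact absurd this (by decide)

/-- `-e_μ ≠ 0` on `(ℤ/4)⁴`. -/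
theorem neg_single_ne_zero (μ : Fin 4) : -(Pi.single μ 1 : TorusSite 4 4) ≠ 0 := by
  intro h; exact single_ne_zero μ (neg_eq_zero.mp h)

/-- `e_μ + e_ν ≠ 0` on `(ℤ/4)⁴`. -/
theorem single_add_single_ne_zero (μ ν : Fin 4) :
    (Pi.single μ 1 : TorusSite 4 4) + Pi.single ν 1 ≠ 0 := by
  intro h
  have := congrFun h μ
  by_cases hμν : μ = ν
  · subst hμν; simp at this; exact absurd this (by decide)
  · simp [Pi.single_eq_of_ne hμν] at this; exact absurd this (by decide)

/-- `-e_ν + e_μ ≠ 0` for `μ ≠ ν`. -/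
theorem neg_single_add_single_ne_zero {μ ν : Fin 4} (h : μ ≠ ν) :
    -(Pi.single ν 1 : TorusSite 4 4) + Pi.single μ 1 ≠ 0 := by
  intro h'
  have := congrFun h' μ
  simp [Pi.single_eq_of_ne h] at this; exact absurd this (by decide)

/-- `2e_μ ≠ 0` on `(ℤ/4)⁴`. -/
theorem two_single_ne_zero (μ : Fin 4) : (Pi.single μ 1 : TorusSite 4 4) + Pi.single μ 1 ≠ 0 :=
  single_add_single_ne_zero μ μ
/-- `3e_μ ≠ 0` on `(ℤ/4)⁴`. -/
theorem three_single_ne_zero (μ : Fin 4) :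
    (Pi.single μ 1 : TorusSite 4 4) + Pi.single μ 1 + Pi.single μ 1 ≠ 0 := by
  intro h; have := congrFun h μ; simp at this; exact absurd this (by decide)
/-- `4e_μ = 0` on `(ℤ/4)⁴`. -/
theorem four_single_eq_zero (μ : Fin 4) :
    (Pi.single μ 1 : TorusSite 4 4) + Pi.single μ 1 + Pi.single μ 1 + Pi.single μ 1 = 0 := by
  funext ν; by_cases h : ν = μ
  · subst h; simp; decide
  · simp [Pi.single_eq_of_ne h]


/-- Off-star edges: the negation of the crux's `star` predicate at `x = y = 0`. -/
theorem off_star {z : TorusSite 4 4} {μ : Fin 4} (h1 : z ≠ 0) (h2 : Site.shift z μ ≠ 0) :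
    ¬ (z = 0 ∨ Site.shift z μ = 0 ∨ z = 0 ∨ Site.shift z μ = 0) := by tauto

/-- **Flat completions of the trivial field over one star are pure gauge at the star's centre.**
If `V` is `1` off the star of the origin and every plaquette holonomy of `V` is trivial, then all
forward links at `0` equal `h := V(0,0)` and all backward links into `0` equal `h⁻¹`. -/
theorem freeStar_pureGauge (V : GaugeConfig 4 4 SU3)
    (hoff : ∀ e : Edge 4 4,
      ¬ (e.1 = 0 ∨ Site.shift e.1 e.2 = 0 ∨ e.1 = 0 ∨ Site.shift e.1 e.2 = 0) → V e = 1)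
    (hflat : ∀ (z : TorusSite 4 4) (i j : Fin 4), i < j → plaquetteHolonomy V z i j = 1) :
    (∀ μ, V (0, μ) = V (0, 0)) ∧ (∀ μ, V (-(Pi.single μ 1), μ) = (V (0, 0))⁻¹) := by
  have hV1 : ∀ (z : TorusSite 4 4) (μ : Fin 4), z ≠ 0 → Site.shift z μ ≠ 0 → V (z, μ) = 1 :=
    fun z μ h1 h2 => hoff (z, μ) (off_star h1 h2)
  -- forward links
  have hfwd : ∀ j : Fin 4, 0 < j → V (0, j) = V (0, 0) := by
    intro j hj
    have hj' : (0 : Fin 4) ≠ j := ne_of_lt hj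
    have h := hflat 0 0 j hj
    rw [plaquetteHolonomy, shift_eq, shift_eq, zero_add, zero_add,
      hV1 (Pi.single 0 1) j (single_ne_zero 0)
        (by rw [shift_eq]; exact single_add_single_ne_zero 0 j),
      hV1 (Pi.single j 1) 0 (single_ne_zero j)
        (by rw [shift_eq]; exact single_add_single_ne_zero j 0),
      mul_one, inv_one, mul_one, mul_inv_eq_one] at h
    exact h.symm
  have hfwd' : ∀ μ : Fin 4, V (0, μ) = V (0, 0) := by
    intro μ
    by_cases hμ : μ = 0
    · rw [hμ]
    · exact hfwd μ (by omega)
  refine ⟨hfwd', fun μ => ?_⟩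
  by_cases hμ : μ = 0
  · -- backward link in direction 0: plaquette at `-e₀` in the plane (0,1)
    subst hμ
    have h := hflat (-(Pi.single 0 1)) 0 1 (by decide)
    have hs1 : Site.shift (-((Pi.single (0 : Fin 4) 1 : TorusSite 4 4))) 0 = 0 := by
      rw [shift_eq, neg_add_cancel]
    have hs2 : Site.shift (-((Pi.single (0 : Fin 4) 1 : TorusSite 4 4))) 1 =
        -(Pi.single 0 1) + Pi.single 1 1 := rfl
    rw [plaquetteHolonomy, hs1, hs2, hfwd 1 (by decide),
      hV1 (-(Pi.single 0 1) + Pi.single 1 1) 0 (neg_single_add_single_ne_zero (by decide))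
        (by rw [shift_eq, neg_add_cancel_comm]; exact single_ne_zero 1),
      hV1 (-(Pi.single 0 1)) 1 (neg_single_ne_zero 0)
        (by rw [shift_eq]; exact neg_single_add_single_ne_zero (by decide)),
      inv_one, mul_one, mul_one] at h
    exact eq_inv_of_mul_eq_one_left h
  · -- backward link in direction μ ≠ 0: plaquette at `-e_μ` in the plane (0,μ)
    have hμ' : (0 : Fin 4) < μ := by omega
    have h := hflat (-(Pi.single μ 1)) 0 μ hμ'
    have hs1 : Site.shift (-(Pi.single μ 1 : TorusSite 4 4)) μ = 0 := by
      rw [shift_eq, neg_add_cancel]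
    have hs2 : Site.shift (-(Pi.single μ 1 : TorusSite 4 4)) 0 =
        -(Pi.single μ 1) + Pi.single 0 1 := rfl
    rw [plaquetteHolonomy, hs1, hs2,
      hV1 (-(Pi.single μ 1)) 0 (neg_single_ne_zero μ)
        (by rw [shift_eq]; exact neg_single_add_single_ne_zero (Ne.symm hμ)),
      hV1 (-(Pi.single μ 1) + Pi.single 0 1) μ (neg_single_add_single_ne_zero (Ne.symm hμ))
        (by rw [shift_eq, neg_add_cancel_comm]; exact single_ne_zero 0),
      one_mul, one_mul, ← _root_.mul_inv_rev, inv_eq_one] at h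
    -- h : V (-(e μ), μ) * V (0,0) = 1
    exact eq_inv_of_mul_eq_one_left h

/-- **Structural zero.**  A configuration that is pure gauge at the origin and trivial elsewhere
has a non-zero parallel colour field, hence a vanishing massless Wilson determinant. -/
theorem det_wilsonDirac_freeStar_eq_zero (V : GaugeConfig 4 4 SU3)
    (hoff : ∀ e : Edge 4 4,
      ¬ (e.1 = 0 ∨ Site.shift e.1 e.2 = 0 ∨ e.1 = 0 ∨ Site.shift e.1 e.2 = 0) → V e = 1)
    (hflat : ∀ (z : TorusSite 4 4) (i j : Fin 4), i < j → plaquetteHolonomy V z i j = 1) :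
    (wilsonDirac (fundamentalRep (Fin 3)) V 0 1).det = 0 := by
  obtain ⟨hfwd, hbwd⟩ := freeStar_pureGauge V hoff hflat
  set h : SU3 := V (0, 0) with hh
  rw [det_wilsonDirac_massless_eq_zero_iff (fundamentalRep (Fin 3))
    fundamentalRep_mem_unitaryGroup V]
  refine ⟨fun p => if p.1 = 0 then (h : Matrix (Fin 3) (Fin 3) ℂ) p.2.1 0
      else (if p.2.1 = 0 then 1 else 0), ?_, ?_⟩
  · intro hzero
    have := congrFun hzero (Pi.single 1 1, 0, 0)
    simp [single_ne_zero 1] at this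
  · intro z μ a α
    simp only [fundamentalRep_apply]
    by_cases hz : z = 0
    · subst hz
      have hne : Site.shift (0 : TorusSite 4 4) μ ≠ 0 := by
        rw [shift_eq, zero_add]; exact single_ne_zero μ
      simp only [hne, if_false, if_true, hfwd μ, mul_ite, mul_one, mul_zero, Finset.sum_ite_eq',
        Finset.mem_univ]
    · by_cases hzμ : Site.shift z μ = 0
      · have hz' : z = -(Pi.single μ 1) :=
          eq_neg_of_add_eq_zero_left (by rw [← shift_eq]; exact hzμ)
        simp only [hzμ, if_true, hz, if_false]
        rw [hz', hbwd μ, ← Matrix.mul_apply, ← Submonoid.coe_mul, inv_mul_cancel, Submonoid.coe_one,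
          Matrix.one_apply]
      · simp only [hzμ, if_false, hz, hoff (z, μ) (off_star hz hzμ), Submonoid.coe_one,
          Matrix.one_apply, ite_mul, one_mul, zero_mul, Finset.sum_ite_eq, Finset.mem_univ, if_true]

/-- The diagonal twist `diag(i, i, −1)` is special unitary. -/
theorem twist_mem_specialUnitaryGroup :
    Matrix.diagonal ![Complex.I, Complex.I, -1] ∈ Matrix.specialUnitaryGroup (Fin 3) ℂ := by
  rw [Matrix.mem_specialUnitaryGroup_iff, Matrix.mem_unitaryGroup_iff]
  constructor
  · rw [Matrix.star_eq_conjTranspose, Matrix.diagonal_conjTranspose, Matrix.diagonal_mul_diagonal,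
      ← Matrix.diagonal_one]
    congr 1
    funext i
    fin_cases i <;> simp
  · rw [Matrix.det_diagonal, Fin.prod_univ_three]
    simp

/-- **No parallel field after a centre-free twist of one link.**  The trivial field with the
single link `(0, ê₀)` replaced by `diag(i, i, −1)` has an invertible massless Wilson operator. -/
theorem det_wilsonDirac_twisted_ne_zero :
    (wilsonDirac (fundamentalRep (Fin 3))
      (fun e : Edge 4 4 => if e = ((0 : TorusSite 4 4), (0 : Fin 4)) then
        (⟨Matrix.diagonal ![Complex.I, Complex.I, -1], twist_mem_specialUnitaryGroup⟩ : SU3) else 1)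
      0 1).det ≠ 0 := by
  rw [Ne, det_wilsonDirac_massless_eq_zero_iff (fundamentalRep (Fin 3))
    fundamentalRep_mem_unitaryGroup]
  rintro ⟨ψ, hψ, hpar⟩
  apply hψ
  funext p
  obtain ⟨z, a, α⟩ := p
  -- the scalar function `f w := ψ (w, a, α)`
  have h1 : ∀ (w : TorusSite 4 4) (μ : Fin 4), (w, μ) ≠ ((0 : TorusSite 4 4), (0 : Fin 4)) →
      ψ (w + Pi.single μ 1, a, α) = ψ (w, a, α) := by
    intro w μ hne
    have := hpar w μ a α
    simpa [hne, Matrix.one_apply, ite_mul, Finset.sum_ite_eq, shift_eq] using this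
  have h0 : (![Complex.I, Complex.I, -1] a) * ψ (Pi.single 0 1, a, α) = ψ (0, a, α) := by
    have := hpar 0 0 a α
    simpa [Matrix.diagonal_apply, ite_mul, Finset.sum_ite_eq, shift_eq] using this
  -- invariance under `e_μ`, `μ ≠ 0`, iterated
  have hμ : ∀ (w : TorusSite 4 4) (μ : Fin 4), μ ≠ 0 → ∀ n : ℕ,
      ψ (w + Pi.single μ (n : ZMod 4), a, α) = ψ (w, a, α) := by
    intro w μ hμ n
    induction n with
    | zero => simp
    | succ n ih =>
      rw [Nat.cast_succ, Pi.single_add, ← add_assoc, h1 _ μ (by simp [hμ]), ih]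
  have hμ' : ∀ (w : TorusSite 4 4) (μ : Fin 4), μ ≠ 0 → ∀ c : ZMod 4,
      ψ (w + Pi.single μ c, a, α) = ψ (w, a, α) := by
    intro w μ hμ0 c
    rw [← ZMod.natCast_zmod_val c]
    exact hμ w μ hμ0 c.val
  -- reduce to the `e₀`-axis
  have hred : ψ (z, a, α) = ψ (Pi.single 0 (z 0), a, α) := by
    conv_lhs => rw [← Finset.univ_sum_single z, Fin.sum_univ_four]
    rw [hμ' _ 3 (by decide), hμ' _ 2 (by decide), hμ' _ 1 (by decide)]
  -- the `e₀`-axis: all four values equal `v := ψ(e₀)`, and the twist kills `v`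
  have h01 : ψ (Pi.single 0 1 + Pi.single 0 1, a, α) = ψ (Pi.single 0 1, a, α) :=
    h1 (Pi.single 0 1) 0 (by simp [single_ne_zero 0])
  have h12 : ψ (Pi.single 0 1 + Pi.single 0 1 + Pi.single 0 1, a, α) =
      ψ (Pi.single 0 1 + Pi.single 0 1, a, α) :=
    h1 (Pi.single 0 1 + Pi.single 0 1) 0 (by simp [two_single_ne_zero 0])
  have h23 : ψ (0, a, α) = ψ (Pi.single 0 1 + Pi.single 0 1 + Pi.single 0 1, a, α) := by
    rw [← four_single_eq_zero 0]
    exact h1 (Pi.single 0 1 + Pi.single 0 1 + Pi.single 0 1) 0 (by simp [three_single_ne_zero 0])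
  have hv : ψ (Pi.single 0 1, a, α) = 0 := by
    have hda : (![Complex.I, Complex.I, -1] a) ≠ 1 := by
      fin_cases a <;> norm_num [Complex.ext_iff]
    have : ((![Complex.I, Complex.I, -1] a) - 1) * ψ (Pi.single 0 1, a, α) = 0 := by
      rw [sub_mul, one_mul, h0, h23, h12, h01, sub_self]
    exact (mul_eq_zero.mp this).resolve_left (sub_ne_zero.mpr hda)
  have hkey : ∀ n : ℕ, n < 4 → ψ (Pi.single 0 (n : ZMod 4), a, α) = 0 := by
    intro n hn
    interval_cases n
    · simpa [h23, h12, h01] using hv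
    · simpa using hv
    · have : ((2 : ℕ) : ZMod 4) = 1 + 1 := by norm_num
      rw [this, Pi.single_add, h01, hv]
    · have : ((3 : ℕ) : ZMod 4) = 1 + 1 + 1 := by norm_num
      rw [this, Pi.single_add, Pi.single_add, h12, h01, hv]
  rw [hred, ← ZMod.natCast_zmod_val (z 0)]
  exact hkey _ (ZMod.val_lt _)

/-! ### Minimisers of the star action over the trivial field are flat -/

/-- Each plaquette term of the `SU(3)` Wilson action is non-negative. -/
theorem wilson_term_nonneg (g : SU3) :
    0 ≤ ((3 : ℕ) : ℝ) - ((fundamentalRep (Fin 3) g).trace).re := by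
  have := Literature.Barriers.QuantumFields.re_trace_le_of_mem_unitaryGroup
    (fundamentalRep_mem_unitaryGroup g)
  linarith

/-- The `SU(3)` Wilson action is non-negative. -/
theorem wilsonAction_nonneg' (V : GaugeConfig 4 4 SU3) :
    0 ≤ wilsonAction (fundamentalRep (Fin 3)) V :=
  Finset.sum_nonneg fun _ _ => wilson_term_nonneg _

/-- Zero Wilson action forces every plaquette holonomy to be trivial. -/
theorem flat_of_wilsonAction_eq_zero (V : GaugeConfig 4 4 SU3)
    (h : wilsonAction (fundamentalRep (Fin 3)) V = 0) (z : TorusSite 4 4) (i j : Fin 4)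
    (hij : i < j) : plaquetteHolonomy V z i j = 1 := by
  unfold wilsonAction at h
  have hterm := congrFun ((Fintype.sum_eq_zero_iff_of_nonneg (fun (p : Plaquette 4 4) =>
    wilson_term_nonneg (plaquetteHolonomy V p.1 p.2.1.1 p.2.1.2))).mp h) ⟨z, ⟨(i, j), hij⟩⟩
  have htr : ((fundamentalRep (Fin 3) (plaquetteHolonomy V z i j)).trace).re = (3 : ℕ) := by
    simp only [Pi.zero_apply] at hterm; linarith
  have := Literature.Barriers.QuantumFields.eq_one_of_re_trace_eq
    (fundamentalRep_mem_unitaryGroup _) htr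
  exact Subtype.ext this

/-- The trivial field has zero Wilson action. -/
theorem wilsonAction_const_one :
    wilsonAction (fundamentalRep (Fin 3)) (fun _ : Edge 4 4 => (1 : SU3)) = 0 := by
  unfold wilsonAction
  refine Finset.sum_eq_zero fun p _ => ?_
  simp [plaquetteHolonomy, Matrix.trace_one]

/-- Continuity of the refitted Wilson action (generic side `L`, so that no concrete `Fintype`
is ever unfolded by unification). -/
theorem continuous_wilsonAction_comp {L : ℕ} [NeZero L]
    {r : GaugeConfig 4 L SU3 → GaugeConfig 4 L SU3}
    (hr : Continuous r) : Continuous fun W => wilsonAction (fundamentalRep (Fin 3)) (r W) :=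
  (continuous_wilsonAction (fundamentalRep (Fin 3)) (continuous_fundamentalRep (Fin 3))).comp hr

/-- Continuity of the refitted fermionic weight (generic side `L`). -/
theorem continuous_normDet_comp {Nf L : ℕ} [NeZero L]
    {r : GaugeConfig 4 L SU3 → GaugeConfig 4 L SU3}
    (hr : Continuous r) (mq : Fin Nf → ℝ) : Continuous fun W => ‖(diracMatrix (r W) mq).det‖ :=
  continuous_norm.comp ((TiltedFlatnessNegative.continuous_diracMatrix mq).comp hr).matrix_det

/-- Continuity of the refitted one-flavour Wilson weight (generic side `L`). -/
theorem continuous_normDetWilson_comp {L : ℕ} [NeZero L]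
    {r : GaugeConfig 4 L SU3 → GaugeConfig 4 L SU3} (hr : Continuous r) (m : ℝ) :
    Continuous fun W => ‖(wilsonDirac (fundamentalRep (Fin 3)) (r W) m 1).det‖ :=
  continuous_norm.comp (((continuous_wilsonDirac (fundamentalRep (Fin 3))
    (continuous_fundamentalRep (Fin 3)) m 1).comp hr).matrix_det)

end FreeStar

end Summit.QuantumFields.QCD.Theorems.TiltedFlatnessNegative
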